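import Summits.NavierStokesRegularity.NavierStokesRegularity.Theorems.TypeIIInviscidRelaxationAxisymSwirlRegularEllipticGate
import Summits.NavierStokesRegularity.NavierStokesRegularity.Theorems.TypeIIInviscidRelaxationAxisymSwirlRegularOffAxisBound
import Summits.NavierStokesRegularity.NavierStokesRegularity.Theorems.ScenarioCensusRowF5lg
import HarnessLib

/-!
# A one-sided continuation criterion in Biot–Savart currency: `x_h·Δu_h = r ∂_z ω_θ ≤ K r²` near the axis

Helper toward the crux `AxisymSwirlRegular` (stmt-NavierStokesRegularity-1964, route TypeIIInviscidRelaxation),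
criterion side of the registered line `radial_inflow_split` (stub `stub_oneSidedRadialCriterion`, ⟨19059⟩:
`x₀u₀ + x₁u₁ = r u_r ≥ −Cν` on an axis tube for SOME `C` ⇒ continuation; a tree theorem for `C < 2`,
`ScenarioCensus.LogGate.oneSidedRadialCriterion_of_lt_two`, open for `C ≥ 2`).  Sequel of
`TypeIIInviscidRelaxationAxisymSwirlRegularEllipticGate` (slice lemma
`RadialInflowEllipticGate.radialMomentum_ge_quadratic_of_radialLaplacian_le`).

The repair census of this crux asks for the Navier–Stokes COUPLING `u_r ↔ ω_θ ↔ Γ`.  The elliptic half of that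
coupling is the Stokes equation `LΨ = −r ω_θ` for the stream function, equivalently `L(r u_r) = r ∂_z ω_θ` with
`L = ∂_r² − (1/r)∂_r + ∂_z²`; in Cartesian form `L(x₀u₀ + x₁u₁) = x₀(Δu)₀ + x₁(Δu)₁ =: x_h·Δu_h` (tree).  The slice
lemma turns a ONE-SIDED bound `x_h·Δu_h ≤ K r²` on a punctured axis tube into the quadratic interpolation
`r u_r ≥ −c r²/ρ² − Kρ⁴/8` of the lateral value `−c = −ρ·sup_{r ≥ ρ} ‖u‖` (off-axis bound `offAxisBound`, CKN),
i.e. into the radial gate with an ARBITRARILY SMALL constant on a thinner tube — and the `C < 2` criterion closes: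

* `hasSmoothExtensionPast_of_radialLaplacian_le` — **criterion**: in the standing class of the stub (classical on
  `[0,T)`, Leray–Hopf from `u 0`, bounded on closed sub-slabs, axisymmetric slices, rapidly decaying datum), if for
  some `K` and `δ > 0`, `x₀(Δu)₀ + x₁(Δu)₁ ≤ K r²` at all `(t,x)` with `t ∈ [0,T)`, `0 < cylRadius x < δ`, then
  `HasSmoothExtensionPast ν 0 u T`.  ANY `K`; one-sided; for divergence-free axisymmetric `u` the hypothesis reads
  `∂_z ω_θ ≤ K r`, i.e. `∂_z(ω_θ/r) ≤ K` — a one-sided bound on ONE derivative of ONE vorticity component near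
  the axis (no gate on `u_r` is assumed: the gate is PRODUCED by the elliptic coupling);
* `radialLaplacianCriterion` — the same on the stub's hypothesis list (universally closed);
* `exists_radialLaplacian_gt_of_not_hasSmoothExtensionPast` — blow-up reading: a solution of the standing class
  that does not extend past `T` has `sup_{0<r<δ} (x_h·Δu_h)/r² = +∞` over `[0,T)` for every `δ > 0`
  (`sup ∂_z(ω_θ/r) = +∞` at points approaching the axis);
* `hasSmoothExtensionPast_of_materialRadialMomentum_le` — the same criterion in DYNAMIC currency through the
  momentum equation (`radialMomentum_transport`): `ν x_h·Δu_h = (∂ₜ + u·∇)Φ − (u₀² + u₁²) + (x₀∂₀p + x₁∂₁p)`, so a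
  one-sided bound `(∂ₜ + u·∇)(r u_r) + r∂_r p − (u_r² + u_θ²) ≤ νK r²` near the axis (radial acceleration beyond
  the cyclostrophic balance at most quadratic in `r`) implies continuation.

Scaling: `∂_z(ω_θ/r)` has dimension `1/(time·length²)`·length… a bound by a fixed `K` up to `T` is subcritical; the
statement is a CRITERION (its a-priori version would join the EQUIV continuum of ⟨1964⟩ by vacuity and is not
filed).  Nothing here proves `stub_oneSidedRadialCriterion`, `AxisymSwirlRegular` or NavierStokesRegularity. [new]
-/

noncomputable section

set_option linter.dupNamespace false

open Set Filter Topology Real WithLp Metric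
open Literature.Analysis.FluidPDE
open scoped InnerProductSpace RealInnerProductSpace Laplacian ContDiff

namespace Summit.NavierStokesRegularity.NavierStokesRegularity.Theorems.RadialInflowEllipticGate

open Summit.NavierStokesRegularity.NavierStokesRegularity.Theorems
open Summit.NavierStokesRegularity.NavierStokesRegularity.Theorems.ScenarioCensus.LogGate

/-! ## §1 The criterion -/

/-- **Continuation under a one-sided bound on `x_h·Δu_h` near the axis.** In the standing class of
`stub_oneSidedRadialCriterion`: if `x₀(Δu)₀ + x₁(Δu)₁ (t,x) ≤ K · r²` whenever `t ∈ [0,T)` and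
`0 < cylRadius x < δ` (some `K`, `δ > 0`), then `HasSmoothExtensionPast ν 0 u T`.
Proof: choose `ρ ≤ δ/2`, `ρ ≤ 1`, `ρ ≤ ν/(K⁺+1)` (so `K⁺ρ⁴ ≤ ν`); the off-axis bound `‖u‖ ≤ M` for `r ≥ ρ`
(`offAxisBound`) gives the lateral gate `Φ ≥ −ρM⁺ =: −c` at `r = ρ` for all `t < T`; the slice lemma gives
`Φ ≥ −c r²/ρ² − K⁺ρ⁴/8 ≥ −ν` on `r < min (ρ/2) (ρ√(ν/(2(c+1))))`, i.e. the radial gate with constant `1 < 2`;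
`oneSidedRadialCriterion_of_lt_two` concludes. [new] -/
theorem hasSmoothExtensionPast_of_radialLaplacian_le {ν T K δ : ℝ} (hν : 0 < ν) (hT : 0 < T) (hδ : 0 < δ)
    {u : ℝ → EuclideanSpace ℝ (Fin 3) → EuclideanSpace ℝ (Fin 3)} {p : ℝ → EuclideanSpace ℝ (Fin 3) → ℝ}
    (hcl : IsClassicalNSSolutionOn (Ico 0 T) ν 0 u p) (hLH : IsLerayHopfOn T ν 0 (u 0) u)
    (hbd : ∀ T' < T, ∃ M : ℝ, ∀ t ∈ Icc 0 T', ∀ x, ‖u t x‖ ≤ M) (hax : ∀ t ∈ Ico 0 T, IsAxisymmetric (u t))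
    (hdec : HasRapidSpatialDecay (u 0))
    (hK : ∀ t ∈ Ico 0 T, ∀ x : EuclideanSpace ℝ (Fin 3), 0 < cylRadius x → cylRadius x < δ →
      x 0 * (Δ (u t)) x 0 + x 1 * (Δ (u t)) x 1 ≤ K * cylRadius x ^ 2) :
    HasSmoothExtensionPast ν 0 u T := by
  -- constants
  set K' : ℝ := max K 0 with hK'_def
  have hK'0 : 0 ≤ K' := le_max_right _ _
  have hKK' : K ≤ K' := le_max_left _ _
  set ρ : ℝ := min (δ / 2) (min 1 (ν / (K' + 1))) with hρ_def
  have hρ0 : 0 < ρ := lt_min (half_pos hδ) (lt_min one_pos (div_pos hν (by positivity)))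
  have hρδ : ρ < δ := (min_le_left _ _).trans_lt (half_lt_self hδ)
  have hρ1 : ρ ≤ 1 := (min_le_right _ _).trans (min_le_left _ _)
  have hρK : ρ ≤ ν / (K' + 1) := (min_le_right _ _).trans (min_le_right _ _)
  have hρ4 : K' * ρ ^ 4 ≤ ν := by
    have h1 : ρ ^ 4 ≤ ρ := by
      have h2 : ρ ^ 3 ≤ 1 := pow_le_one₀ hρ0.le hρ1
      calc ρ ^ 4 = ρ ^ 3 * ρ := by ring
        _ ≤ 1 * ρ := mul_le_mul_of_nonneg_right h2 hρ0.le
        _ = ρ := one_mul ρ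
    have h3 : K' * ρ ≤ ν := by
      have h4 : K' * (ν / (K' + 1)) ≤ ν := by
        rw [mul_div_assoc', div_le_iff₀ (by positivity)]
        nlinarith
      exact (mul_le_mul_of_nonneg_left hρK hK'0).trans h4
    linarith [mul_le_mul_of_nonneg_left h1 hK'0]
  -- the off-axis bound at radius `ρ`, lateral gate constant `c`
  obtain ⟨M, hM⟩ := offAxisBound ν T hν hT u p hcl hLH hbd hax hdec ρ hρ0
  set c : ℝ := ρ * max M 0 with hc_def
  have hc0 : 0 ≤ c := by positivity
  -- the final tube
  set s : ℝ := Real.sqrt (ν / (2 * (c + 1))) with hs_def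
  have hs0 : 0 < s := Real.sqrt_pos.2 (by positivity)
  have hs2 : s ^ 2 = ν / (2 * (c + 1)) := Real.sq_sqrt (by positivity)
  set δ' : ℝ := min (ρ / 2) (ρ * s) with hδ'_def
  have hδ'0 : 0 < δ' := lt_min (half_pos hρ0) (mul_pos hρ0 hs0)
  have hδ'ρ : δ' < ρ := (min_le_left _ _).trans_lt (half_lt_self hρ0)
  refine oneSidedRadialCriterion_of_lt_two (C := 1) hν hT one_lt_two hδ'0 hcl hLH hbd hax hdec ?_
  intro t ht x hxδ'
  rcases (cylRadius_nonneg x).eq_or_lt with hx0 | hx0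
  · -- on the axis `Φ = 0`
    have h0 := (cylRadius_eq_zero_iff x).1 hx0.symm
    rw [h0.1, h0.2]
    nlinarith
  have hxρ : cylRadius x < ρ := hxδ'.trans hδ'ρ
  -- slice data at time `t`
  have hv2 : ContDiff ℝ 2 (u t) := (hcl.contDiff_velocity ht).of_le (by norm_cast)
  obtain ⟨Bt, hBt⟩ := hbd t ht.2
  have hBslice : ∀ y, ‖u t y‖ ≤ Bt := fun y => hBt t ⟨ht.1, le_rfl⟩ y
  have hlap_t : ∀ y : EuclideanSpace ℝ (Fin 3), 0 < cylRadius y → cylRadius y < ρ →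
      y 0 * (Δ (u t)) y 0 + y 1 * (Δ (u t)) y 1 ≤ K' * cylRadius y ^ 2 := fun y hy hyρ =>
    (hK t ht y hy (hyρ.trans hρδ)).trans (mul_le_mul_of_nonneg_right hKK' (sq_nonneg _))
  have hgate_t : ∀ y : EuclideanSpace ℝ (Fin 3), cylRadius y = ρ → -c ≤ y 0 * u t y 0 + y 1 * u t y 1 := by
    intro y hy
    have h1 := neg_cylRadius_mul_norm_le_radialMomentum y (u t y)
    have h2 : ‖u t y‖ ≤ max M 0 := (hM t ht y hy.symm.le).trans (le_max_left _ _)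
    have h3 : cylRadius y * ‖u t y‖ ≤ ρ * max M 0 := by
      rw [hy]; exact mul_le_mul_of_nonneg_left h2 hρ0.le
    simp only [hc_def]
    linarith
  have hΦ := radialMomentum_ge_quadratic_of_radialLaplacian_le hv2 (hax t ht) hBslice hρ0 hc0 hK'0
    hlap_t hgate_t hx0 hxρ
  -- `c r²/ρ² ≤ ν/2` and `K'(ρ⁴ - r⁴)/8 ≤ ν/8`
  have h1 : c * cylRadius x ^ 2 / ρ ^ 2 ≤ ν / 2 := by
    have hrs : cylRadius x < ρ * s := hxδ'.trans_le (min_le_right _ _)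
    have hrs2 : cylRadius x ^ 2 ≤ (ρ * s) ^ 2 := pow_le_pow_left₀ (cylRadius_nonneg x) hrs.le 2
    have h2 : cylRadius x ^ 2 / ρ ^ 2 ≤ s ^ 2 := by
      rw [div_le_iff₀ (by positivity)]
      nlinarith
    have h3 : c * s ^ 2 ≤ ν / 2 := by
      rw [hs2, mul_div_assoc', div_le_iff₀ (by positivity)]
      nlinarith
    calc c * cylRadius x ^ 2 / ρ ^ 2 = c * (cylRadius x ^ 2 / ρ ^ 2) := by ring
      _ ≤ c * s ^ 2 := mul_le_mul_of_nonneg_left h2 hc0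
      _ ≤ ν / 2 := h3
  have h2 : K' / 8 * (ρ ^ 4 - cylRadius x ^ 4) ≤ ν / 8 := by
    have h3 : 0 ≤ cylRadius x ^ 4 := by positivity
    nlinarith
  linarith

/-- **The criterion on the stub's hypothesis list** (universally closed; the gate hypothesis
`∃ C δ, … −(Cν) ≤ x₀u₀ + x₁u₁` of `stub_oneSidedRadialCriterion` REPLACED by the one-sided bound on
`x₀(Δu)₀ + x₁(Δu)₁`). [new] -/
theorem radialLaplacianCriterion :
    ∀ (ν T : ℝ), 0 < ν → 0 < T →
      ∀ (u : ℝ → EuclideanSpace ℝ (Fin 3) → EuclideanSpace ℝ (Fin 3)) (p : ℝ → EuclideanSpace ℝ (Fin 3) → ℝ),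
      IsClassicalNSSolutionOn (Ico 0 T) ν 0 u p → IsLerayHopfOn T ν 0 (u 0) u →
      (∀ T' < T, ∃ M : ℝ, ∀ t ∈ Icc 0 T', ∀ x, ‖u t x‖ ≤ M) → (∀ t ∈ Ico 0 T, IsAxisymmetric (u t)) →
      HasRapidSpatialDecay (u 0) →
      (∃ K δ : ℝ, 0 < δ ∧ ∀ t ∈ Ico 0 T, ∀ x : EuclideanSpace ℝ (Fin 3), 0 < cylRadius x → cylRadius x < δ →
        x 0 * (Δ (u t)) x 0 + x 1 * (Δ (u t)) x 1 ≤ K * cylRadius x ^ 2) →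
      HasSmoothExtensionPast ν 0 u T := by
  rintro ν T hν hT u p hcl hLH hbd hax hdec ⟨K, δ, hδ, hK⟩
  exact hasSmoothExtensionPast_of_radialLaplacian_le hν hT hδ hcl hLH hbd hax hdec hK

/-- **Blow-up reading.** In the standing class, a solution that does NOT extend smoothly past `T` has, for every
`K` and every `δ > 0`, a time `t ∈ [0,T)` and a point `x` with `0 < cylRadius x < δ` where
`x₀(Δu)₀ + x₁(Δu)₁ (t,x) > K · r²` (for divergence-free axisymmetric `u`: `∂_z(ω_θ/r)(t,x) > K`). [new] -/
theorem exists_radialLaplacian_gt_of_not_hasSmoothExtensionPast {ν T : ℝ} (hν : 0 < ν) (hT : 0 < T)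
    {u : ℝ → EuclideanSpace ℝ (Fin 3) → EuclideanSpace ℝ (Fin 3)} {p : ℝ → EuclideanSpace ℝ (Fin 3) → ℝ}
    (hcl : IsClassicalNSSolutionOn (Ico 0 T) ν 0 u p) (hLH : IsLerayHopfOn T ν 0 (u 0) u)
    (hbd : ∀ T' < T, ∃ M : ℝ, ∀ t ∈ Icc 0 T', ∀ x, ‖u t x‖ ≤ M) (hax : ∀ t ∈ Ico 0 T, IsAxisymmetric (u t))
    (hdec : HasRapidSpatialDecay (u 0)) (hno : ¬ HasSmoothExtensionPast ν 0 u T)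
    (K : ℝ) {δ : ℝ} (hδ : 0 < δ) :
    ∃ t ∈ Ico 0 T, ∃ x : EuclideanSpace ℝ (Fin 3), 0 < cylRadius x ∧ cylRadius x < δ ∧
      K * cylRadius x ^ 2 < x 0 * (Δ (u t)) x 0 + x 1 * (Δ (u t)) x 1 := by
  by_contra hcon
  refine hno (hasSmoothExtensionPast_of_radialLaplacian_le (K := K) hν hT hδ hcl hLH hbd hax hdec ?_)
  intro t ht x hx hxδ
  by_contra hlt
  exact hcon ⟨t, ht, x, hx, hxδ, lt_of_not_ge hlt⟩

/-! ## §2 Dynamic currency: radial acceleration beyond the cyclostrophic balance -/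

/-- **`ν x_h·Δu_h` through the momentum equation.** For a classical solution of the unforced system on `[0,T)`:
`ν (x₀(Δu)₀ + x₁(Δu)₁) = (∂ₜΦ + (u·∇)Φ) − (u₀² + u₁²) + (x₀∂₀p + x₁∂₁p)` at every `(t,x)`, `t ∈ [0,T)`, where
`Φ = x₀u₀ + x₁u₁` (`radialMomentum_transport` + `laplacian_radialMomentum`). [folklore] -/
theorem nu_mul_radialLaplacian_eq {ν T : ℝ}
    {u : ℝ → EuclideanSpace ℝ (Fin 3) → EuclideanSpace ℝ (Fin 3)} {p : ℝ → EuclideanSpace ℝ (Fin 3) → ℝ}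
    (hcl : IsClassicalNSSolutionOn (Ico 0 T) ν 0 u p) {t : ℝ} (ht : t ∈ Ico 0 T) (x : EuclideanSpace ℝ (Fin 3)) :
    ν * (x 0 * (Δ (u t)) x 0 + x 1 * (Δ (u t)) x 1) =
      (timeDerivWithin (Ico 0 T) (fun s y => y 0 * u s y 0 + y 1 * u s y 1) t x
        + convect (u t) (fun y : EuclideanSpace ℝ (Fin 3) => y 0 * u t y 0 + y 1 * u t y 1) x)
      - ((u t x 0) ^ 2 + (u t x 1) ^ 2)
      + (x 0 * fderiv ℝ (p t) x (EuclideanSpace.single 0 1) + x 1 * fderiv ℝ (p t) x (EuclideanSpace.single 1 1)) := by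
  have hU2 : ContDiff ℝ 2 (u t) := (hcl.contDiff_velocity ht).of_le (by norm_cast)
  have key := radialMomentum_transport hcl ht (uniqueDiffOn_Ico 0 T t ht) x
  rw [laplacian_radialMomentum hU2 x] at key
  simp only [Pi.zero_apply, PiLp.zero_apply, mul_zero, add_zero] at key
  linarith

/-- **Continuation under a one-sided bound on the radial acceleration beyond the cyclostrophic balance.** In the
standing class of the stub: if for some `K`, `δ > 0`,
`(∂ₜΦ + (u·∇)Φ) − (u₀² + u₁²) + (x₀∂₀p + x₁∂₁p) ≤ ν K r²` at all `(t,x)` with `t ∈ [0,T)`, `0 < cylRadius x < δ`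
(in cylindrical terms `(∂ₜ + u·∇)(r u_r) + r∂_r p − (u_r² + u_θ²) ≤ νK r²`), then the solution extends smoothly
past `T`. (`nu_mul_radialLaplacian_eq` + `hasSmoothExtensionPast_of_radialLaplacian_le`.) [new] -/
theorem hasSmoothExtensionPast_of_materialRadialMomentum_le {ν T K δ : ℝ} (hν : 0 < ν) (hT : 0 < T)
    (hδ : 0 < δ)
    {u : ℝ → EuclideanSpace ℝ (Fin 3) → EuclideanSpace ℝ (Fin 3)} {p : ℝ → EuclideanSpace ℝ (Fin 3) → ℝ}
    (hcl : IsClassicalNSSolutionOn (Ico 0 T) ν 0 u p) (hLH : IsLerayHopfOn T ν 0 (u 0) u)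
    (hbd : ∀ T' < T, ∃ M : ℝ, ∀ t ∈ Icc 0 T', ∀ x, ‖u t x‖ ≤ M) (hax : ∀ t ∈ Ico 0 T, IsAxisymmetric (u t))
    (hdec : HasRapidSpatialDecay (u 0))
    (hK : ∀ t ∈ Ico 0 T, ∀ x : EuclideanSpace ℝ (Fin 3), 0 < cylRadius x → cylRadius x < δ →
      (timeDerivWithin (Ico 0 T) (fun s y => y 0 * u s y 0 + y 1 * u s y 1) t x
        + convect (u t) (fun y : EuclideanSpace ℝ (Fin 3) => y 0 * u t y 0 + y 1 * u t y 1) x)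
      - ((u t x 0) ^ 2 + (u t x 1) ^ 2)
      + (x 0 * fderiv ℝ (p t) x (EuclideanSpace.single 0 1) + x 1 * fderiv ℝ (p t) x (EuclideanSpace.single 1 1))
        ≤ ν * K * cylRadius x ^ 2) :
    HasSmoothExtensionPast ν 0 u T := by
  refine hasSmoothExtensionPast_of_radialLaplacian_le (K := K) hν hT hδ hcl hLH hbd hax hdec ?_
  intro t ht x hx hxδ
  have h1 := hK t ht x hx hxδ
  rw [← nu_mul_radialLaplacian_eq hcl ht x] at h1
  have h2 : ν * (x 0 * (Δ (u t)) x 0 + x 1 * (Δ (u t)) x 1) ≤ ν * (K * cylRadius x ^ 2) := by linarith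
  exact le_of_mul_le_mul_left h2 hν

end Summit.NavierStokesRegularity.NavierStokesRegularity.Theorems.RadialInflowEllipticGate

end
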